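import Mathlib
import HarnessLib

/-!
# Fischler–Zudilin: Nesterenko's criterion refined by common divisors (Theorem 2)

Topic `Literature/NumberTheory/Irrationality/FischlerZudilin2010`. Typed, cited statement — now PROVED,
`theorem2_holds`, at the end of the file — of
S. Fischler, W. Zudilin, *A refinement of Nesterenko's linear independence criterion with applications to
zeta values*, Math. Ann. **347** (2010) 739–763 [FischlerZudilin2010], §1:

"(N) Let `ξ₀,…,ξ_r` be real numbers, with `r ≥ 1`. Let `0 < α < 1` and `β > 1`. For any `n ≥ 1`, let
`ℓ_{0,n},…,ℓ_{r,n}` be integers such that `lim_n |Σᵢ ℓ_{i,n}ξᵢ|^{1/n} = α` and `limsup_n |ℓ_{i,n}|^{1/n} ≤ β`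
for any `i`." — "**Theorem 2.** Assume that hypothesis (N) holds. For any `n ≥ 1`, let `δ_n` be a common
positive divisor of `ℓ_{1,n},…,ℓ_{r,n}`. Assume that `αβ < liminf_n (gcd(δ_n, δ_{n+1}))^{1/n}`. Then
`dim_ℚ Span_ℚ(ξ₀,…,ξ_r) ≥ 3`."

(Theorem A there = Nesterenko's criterion, tree: `Literature.NumberTheory.Transcendental.nesterenko_criterion`,
PROVED; Theorem 1 — the general refinement with divisors `δ_{i,n}` and `s ≥ τ + γ₁ + ⋯ + γ_s` — is not
typed here.) Why the cell (pub-zeta5; HONEST FRAMING: systematic search; no irrationality claim unless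
certified) wants it: three-term families (forms in `1, ζ(3), ζ(5)`, or `1, ζ(5), ζ(7)` after Brown–Zudilin's
"setting ζ(2) = 0") have coefficients with large common divisors (`Φ_n`-type factors); Theorem 2 is the
printed criterion turning such a family into "`1, ξ₁, ξ₂` linearly independent", i.e. BOTH irrational.

**Theorem 2 is PROVED** below (`theorem2_holds`, the discharge of the named fact `theorem2`) by the
source's own one-page argument (Sect. 2.2, Proposition 1): adapted basis, `2 × 2` determinants of
consecutive coordinate vectors divisible by `gcd(δ_n, δ_{n+1})` and eventually smaller than it, hence zero;
eventual proportionality to a fixed integer vector; a lower bound for `|Σ ℓ_{i,n}ξ_i|` contradicting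
`α < 1`. (The source's Proposition 1 is used in the form needed for Theorem 2 — forms eventually non-zero
and tending to `0` — as private lemmas.)

Rendering (junk-free): `limsup ≤ β` is stated as `∀ β' > β, eventually |ℓ_{i,n}|^{1/n} ≤ β'`; the liminf
condition as `∃ g > αβ, eventually g ≤ gcd(δ_n,δ_{n+1})^{1/n}`; the dimension as `Module.finrank ℚ` of the
`ℚ`-span of `{ξ₀,…,ξ_r}` in `ℝ`, exactly as in the tree's `nesterenko_criterion`.
-/

noncomputable section

open Filter Finset
open scoped Topology

namespace Literature.NumberTheory.Irrationality.FischlerZudilin2010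

/-- **Fischler–Zudilin 2010, Theorem 2** (named fact, statement only): under hypothesis (N) for
`ξ : Fin (r+1) → ℝ` and integer forms `ℓ_{i,n}` (rate `|Σ ℓ_{i,n}ξᵢ|^{1/n} → α ∈ (0,1)`,
`limsup |ℓ_{i,n}|^{1/n} ≤ β`, `β > 1`), if `δ_n > 0` divides `ℓ_{1,n},…,ℓ_{r,n}` for `n ≥ 1` and
`αβ < liminf gcd(δ_n,δ_{n+1})^{1/n}`, then `dim_ℚ Span_ℚ(ξ₀,…,ξ_r) ≥ 3`.
[cite: FischlerZudilin2010, Theorem 2] -/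
def theorem2 : Prop :=
  ∀ (r : ℕ) (ξ : Fin (r + 1) → ℝ) (ℓ : ℕ → Fin (r + 1) → ℤ) (α β : ℝ) (δ : ℕ → ℕ),
    1 ≤ r → 0 < α → α < 1 → 1 < β →
    Tendsto (fun n : ℕ => |∑ i, (ℓ n i : ℝ) * ξ i| ^ ((1 : ℝ) / n)) atTop (𝓝 α) →
    (∀ i, ∀ β' : ℝ, β < β' → ∀ᶠ n : ℕ in atTop, |(ℓ n i : ℝ)| ^ ((1 : ℝ) / n) ≤ β') →
    (∀ n : ℕ, 1 ≤ n → 0 < δ n ∧ ∀ i : Fin (r + 1), i ≠ 0 → (δ n : ℤ) ∣ ℓ n i) →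
    (∃ g : ℝ, α * β < g ∧
      ∀ᶠ n : ℕ in atTop, g ≤ ((Nat.gcd (δ n) (δ (n + 1)) : ℕ) : ℝ) ^ ((1 : ℝ) / n)) →
    3 ≤ Module.finrank ℚ (Submodule.span ℚ (Set.range ξ))

/-! ### Proof of Theorem 2 -/

/-- Parallelism of integer vectors is transitive through a nonzero vector. [folklore] -/
private theorem cross_trans {a₁ a₂ b₁ b₂ c₁ c₂ : ℤ} (hb : b₁ ≠ 0 ∨ b₂ ≠ 0)
    (h₁ : a₁ * b₂ = b₁ * a₂) (h₂ : b₁ * c₂ = c₁ * b₂) : a₁ * c₂ = c₁ * a₂ := by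
  rcases hb with hb1 | hb2
  · have key : b₁ * (a₁ * c₂ - c₁ * a₂) = 0 := by linear_combination a₁ * h₂ + c₁ * h₁
    have := (mul_eq_zero.1 key).resolve_left hb1
    linarith
  · have key : b₂ * (a₁ * c₂ - c₁ * a₂) = 0 := by linear_combination c₂ * h₁ + a₂ * h₂
    have := (mul_eq_zero.1 key).resolve_left hb2
    linarith

/-- The determinant argument of [FischlerZudilin2010, §2.2, proof of Proposition 1], in coordinates:
if every `ξ_i = (G_i v₁ + F_i v₂)/d` with integers `G_i, F_i`, `F_0 = 0`, `v₁ ≠ 0`, and the forms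
`L_n = Σ ℓ_{i,n} ξ_i` are eventually non-zero, tend to `0`, with `δ_n ∣ ℓ_{i,n}` (`i ≥ 1`) and
`C·(‖ℓ_n‖₁|L_{n+1}| + ‖ℓ_{n+1}‖₁|L_n|) < gcd(δ_n, δ_{n+1})` eventually for every `C`, then contradiction.
[cite: FischlerZudilin2010, Sect. 2.2, proof of Proposition 1] -/
private theorem core (r : ℕ) (ξ : Fin (r + 1) → ℝ) (ℓ : ℕ → Fin (r + 1) → ℤ) (δ : ℕ → ℕ)
    (v₁ v₂ : ℝ) (hv₁ : v₁ ≠ 0) (G F : Fin (r + 1) → ℤ) (hF0 : F 0 = 0) (d : ℕ) (hd : 0 < d)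
    (hξ : ∀ i, (d : ℝ) * ξ i = G i * v₁ + F i * v₂)
    (hδ : ∀ᶠ n in atTop, 0 < δ n ∧ ∀ i : Fin (r + 1), i ≠ 0 → (δ n : ℤ) ∣ ℓ n i)
    (hne : ∀ᶠ n in atTop, ∑ i, (ℓ n i : ℝ) * ξ i ≠ 0)
    (hlim : Tendsto (fun n => ∑ i, (ℓ n i : ℝ) * ξ i) atTop (𝓝 0))
    (hsmall : ∀ C : ℝ, ∀ᶠ n in atTop,
      C * ((∑ i, |(ℓ n i : ℝ)|) * |∑ i, (ℓ (n + 1) i : ℝ) * ξ i| +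
           (∑ i, |(ℓ (n + 1) i : ℝ)|) * |∑ i, (ℓ n i : ℝ) * ξ i|) <
        (Nat.gcd (δ n) (δ (n + 1)) : ℝ)) : False := by
  set L : ℕ → ℝ := fun n => ∑ i, (ℓ n i : ℝ) * ξ i with hL
  set S : ℕ → ℝ := fun n => ∑ i, |(ℓ n i : ℝ)| with hS
  set X : ℕ → ℤ := fun n => ∑ i, ℓ n i * G i with hX
  set Y : ℕ → ℤ := fun n => ∑ i, ℓ n i * F i with hY
  have hd0 : (d : ℝ) ≠ 0 := by positivity
  -- `d L_n = X_n v₁ + Y_n v₂`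
  have hdL : ∀ n, (d : ℝ) * L n = (X n : ℝ) * v₁ + (Y n : ℝ) * v₂ := by
    intro n
    simp only [hL, hX, hY, Int.cast_sum, Int.cast_mul, Finset.mul_sum, Finset.sum_mul]
    rw [← Finset.sum_add_distrib]
    refine Finset.sum_congr rfl fun i _ => ?_
    have := hξ i
    calc (d : ℝ) * ((ℓ n i : ℝ) * ξ i) = (ℓ n i : ℝ) * ((d : ℝ) * ξ i) := by ring
      _ = _ := by rw [this]; ring
  -- `δ_n ∣ Y_n` eventually
  have hδY : ∀ᶠ n in atTop, (δ n : ℤ) ∣ Y n := by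
    filter_upwards [hδ] with n hn
    refine Finset.dvd_sum fun i _ => ?_
    by_cases hi : i = 0
    · subst hi; simp [hF0]
    · exact Dvd.dvd.mul_right (hn.2 i hi) _
  -- sizes
  set MF : ℝ := ∑ i, |(F i : ℝ)| with hMF
  have hYle : ∀ n, |(Y n : ℝ)| ≤ MF * S n := by
    intro n
    simp only [hY, Int.cast_sum, Int.cast_mul]
    refine (Finset.abs_sum_le_sum_abs _ _).trans ?_
    rw [hMF, Finset.sum_mul]
    refine Finset.sum_le_sum fun i _ => ?_
    rw [abs_mul, mul_comm]
    refine mul_le_mul_of_nonneg_left ?_ (abs_nonneg _)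
    exact Finset.single_le_sum (f := fun j => |(ℓ n j : ℝ)|) (fun j _ => abs_nonneg _)
      (Finset.mem_univ i)
  -- the determinant
  set Δ : ℕ → ℤ := fun n => X n * Y (n + 1) - X (n + 1) * Y n with hΔ
  have hvΔ : ∀ n, v₁ * (Δ n : ℝ) = (d : ℝ) * (L n * Y (n + 1) - L (n + 1) * Y n) := by
    intro n
    simp only [hΔ, Int.cast_sub, Int.cast_mul]
    linear_combination (-(Y (n + 1) : ℝ)) * hdL n + (Y n : ℝ) * hdL (n + 1)
  have hΔle : ∀ n, |(Δ n : ℝ)| ≤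
      ((d : ℝ) * MF / |v₁|) * (S n * |L (n + 1)| + S (n + 1) * |L n|) := by
    intro n
    have hv : 0 < |v₁| := abs_pos.2 hv₁
    have h1 : |L n * (Y (n + 1) : ℝ) - L (n + 1) * Y n| ≤
        |L n| * (MF * S (n + 1)) + |L (n + 1)| * (MF * S n) := by
      refine (abs_sub _ _).trans ?_
      rw [abs_mul, abs_mul]
      gcongr
      · exact hYle (n + 1)
      · exact hYle n
    have key : |v₁| * |(Δ n : ℝ)| ≤
        |v₁| * (((d : ℝ) * MF / |v₁|) * (S n * |L (n + 1)| + S (n + 1) * |L n|)) := by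
      rw [← abs_mul, hvΔ n, abs_mul, Nat.abs_cast]
      calc (d : ℝ) * |L n * (Y (n + 1) : ℝ) - L (n + 1) * Y n|
          ≤ (d : ℝ) * (|L n| * (MF * S (n + 1)) + |L (n + 1)| * (MF * S n)) := by gcongr
        _ = |v₁| * (((d : ℝ) * MF / |v₁|) * (S n * |L (n + 1)| + S (n + 1) * |L n|)) := by
            field_simp
            ring
    exact le_of_mul_le_mul_left key hv
  -- `Δ_n = 0` eventually
  have hΔ0 : ∀ᶠ n in atTop, Δ n = 0 := by
    have hδY' : ∀ᶠ n in atTop, (δ (n + 1) : ℤ) ∣ Y (n + 1) :=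
      (tendsto_add_atTop_nat 1).eventually hδY
    filter_upwards [hδY, hδY', hsmall ((d : ℝ) * MF / |v₁|)] with n h1 h2 h3
    have hg : ((Nat.gcd (δ n) (δ (n + 1)) : ℕ) : ℤ) ∣ Δ n := by
      have g1 : ((Nat.gcd (δ n) (δ (n + 1)) : ℕ) : ℤ) ∣ Y n :=
        (Int.natCast_dvd_natCast.2 (Nat.gcd_dvd_left _ _)).trans h1
      have g2 : ((Nat.gcd (δ n) (δ (n + 1)) : ℕ) : ℤ) ∣ Y (n + 1) :=
        (Int.natCast_dvd_natCast.2 (Nat.gcd_dvd_right _ _)).trans h2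
      exact dvd_sub (Dvd.dvd.mul_left g2 _) (Dvd.dvd.mul_left g1 _)
    refine Int.eq_zero_of_abs_lt_dvd hg ?_
    have : |(Δ n : ℝ)| < (Nat.gcd (δ n) (δ (n + 1)) : ℝ) := (hΔle n).trans_lt h3
    rw [← Int.cast_abs] at this
    exact_mod_cast this
  -- from a rank `N` on: `Δ_n = 0` and `L_n ≠ 0`
  obtain ⟨N, hN⟩ := eventually_atTop.1 (hΔ0.and hne)
  have hw_ne : ∀ n, N ≤ n → X n ≠ 0 ∨ Y n ≠ 0 := by
    intro n hn
    by_contra h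
    push Not at h
    have : (d : ℝ) * L n = 0 := by rw [hdL n, h.1, h.2]; simp
    exact (hN n hn).2 ((mul_eq_zero.1 this).resolve_left hd0)
  -- all `(X_n, Y_n)`, `n ≥ N`, are parallel to `(X_N, Y_N)`
  have hpar : ∀ n, N ≤ n → X N * Y n = X n * Y N := by
    intro n hn
    induction n, hn using Nat.le_induction with
    | base => ring
    | succ n hn ih =>
      have hz : X n * Y (n + 1) = X (n + 1) * Y n := sub_eq_zero.1 (hN n hn).1
      exact cross_trans (hw_ne n hn) ih hz
  -- Bezout: `γ = gcd(X_N, Y_N) = a X_N + b Y_N`; then `γ L_n = k_n L_N` with `k_n ∈ ℤ`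
  set γ : ℕ := Int.gcd (X N) (Y N) with hγ
  have hγpos : 0 < γ := Int.gcd_pos_iff.2 (hw_ne N le_rfl)
  set a : ℤ := Int.gcdA (X N) (Y N) with ha
  set b : ℤ := Int.gcdB (X N) (Y N) with hb
  have hbez : (γ : ℤ) = X N * a + Y N * b := Int.gcd_eq_gcd_ab (X N) (Y N)
  have hk : ∀ n, N ≤ n → (γ : ℝ) * L n = ((a * X n + b * Y n : ℤ) : ℝ) * L N := by
    intro n hn
    have hp := hpar n hn
    have e1 : (γ : ℤ) * X n = (a * X n + b * Y n) * X N := by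
      rw [hbez]; linear_combination (-b) * hp
    have e2 : (γ : ℤ) * Y n = (a * X n + b * Y n) * Y N := by
      rw [hbez]; linear_combination a * hp
    have e1' : (γ : ℝ) * (X n : ℝ) = ((a * X n + b * Y n : ℤ) : ℝ) * (X N : ℝ) := by
      exact_mod_cast e1
    have e2' : (γ : ℝ) * (Y n : ℝ) = ((a * X n + b * Y n : ℤ) : ℝ) * (Y N : ℝ) := by
      exact_mod_cast e2
    have h1 := hdL n
    have h2 := hdL N
    have : (d : ℝ) * ((γ : ℝ) * L n) = (d : ℝ) * (((a * X n + b * Y n : ℤ) : ℝ) * L N) := by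
      calc (d : ℝ) * ((γ : ℝ) * L n) = (γ : ℝ) * ((d : ℝ) * L n) := by ring
        _ = (γ : ℝ) * (X n : ℝ) * v₁ + (γ : ℝ) * (Y n : ℝ) * v₂ := by rw [h1]; ring
        _ = ((a * X n + b * Y n : ℤ) : ℝ) * ((X N : ℝ) * v₁ + (Y N : ℝ) * v₂) := by
            rw [e1', e2']; ring
        _ = _ := by rw [← h2]; ring
    exact mul_left_cancel₀ hd0 this
  -- hence `|L_n| ≥ |L_N|/γ` for `n ≥ N`, contradicting `L_n → 0`
  have hLN : 0 < |L N| := abs_pos.2 (hN N le_rfl).2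
  have hγ0 : (0 : ℝ) < γ := by exact_mod_cast hγpos
  have hlow : ∀ n, N ≤ n → |L N| / γ ≤ |L n| := by
    intro n hn
    have hkn := hk n hn
    have hk0 : (a * X n + b * Y n : ℤ) ≠ 0 := by
      intro h0
      rw [h0, Int.cast_zero, zero_mul] at hkn
      exact (hN n hn).2 ((mul_eq_zero.1 hkn).resolve_left hγ0.ne')
    have hk1 : (1 : ℝ) ≤ |((a * X n + b * Y n : ℤ) : ℝ)| := by
      rw [← Int.cast_abs]; exact_mod_cast Int.one_le_abs hk0
    rw [div_le_iff₀ hγ0]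
    calc |L N| = 1 * |L N| := (one_mul _).symm
      _ ≤ |((a * X n + b * Y n : ℤ) : ℝ)| * |L N| := by gcongr
      _ = |(γ : ℝ) * L n| := by rw [hkn, abs_mul]
      _ = |L n| * γ := by rw [abs_mul, Nat.abs_cast, mul_comm]
  have hev : ∀ᶠ n in atTop, |L n| < |L N| / γ := by
    have hc : 0 < |L N| / γ := div_pos hLN hγ0
    have h0 : Tendsto (fun n => |L n|) atTop (𝓝 0) := by
      simpa using hlim.abs
    exact h0.eventually (eventually_lt_nhds hc)
  obtain ⟨M, hM⟩ := eventually_atTop.1 hev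
  have h1 := hM (max M N) (le_max_left _ _)
  have h2 := hlow (max M N) (le_max_right _ _)
  linarith


/-- If `dim_ℚ Span_ℚ(ξ₀,…,ξ_r) ≤ 2`, there are reals `v₁ ≠ 0`, `v₂` and rationals `g_i, f_i` with `f₀ = 0`
and `ξ_i = g_i v₁ + f_i v₂` (the normalisation "`ξ₀ = 1`, `ξ₂,…,ξ_r ∈ ℚ + ℚξ₁`" of the source, without
dividing by `ξ₀`). [cite: FischlerZudilin2010, Sect. 2.2, proof of Proposition 1 (first paragraph)] -/
private theorem exists_coords (r : ℕ) (ξ : Fin (r + 1) → ℝ)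
    (h : Module.finrank ℚ (Submodule.span ℚ (Set.range ξ)) ≤ 2) :
    ∃ (v₁ v₂ : ℝ) (g f : Fin (r + 1) → ℚ), v₁ ≠ 0 ∧ f 0 = 0 ∧
      ∀ i, ξ i = (g i : ℝ) * v₁ + (f i : ℝ) * v₂ := by
  classical
  set V := Submodule.span ℚ (Set.range ξ) with hV
  haveI : FiniteDimensional ℚ V := FiniteDimensional.span_of_finite ℚ (Set.finite_range ξ)
  have hmem : ∀ i, ξ i ∈ V := fun i => Submodule.subset_span ⟨i, rfl⟩
  -- main step: a nonzero `u ∈ V` with `ξ 0 ∈ ℚ u`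
  have main : ∀ (u : ℝ) (c₀ : ℚ), u ≠ 0 → u ∈ V → ξ 0 = (c₀ : ℝ) * u →
      ∃ (v₂ : ℝ) (g f : Fin (r + 1) → ℚ), f 0 = 0 ∧
        ∀ i, ξ i = (g i : ℝ) * u + (f i : ℝ) * v₂ := by
    intro u c₀ hu huV h0
    by_cases hsub : V ≤ Submodule.span ℚ {u}
    · have hc : ∀ i, ∃ c : ℚ, ξ i = (c : ℝ) * u := by
        intro i
        obtain ⟨c, hc⟩ := Submodule.mem_span_singleton.1 (hsub (hmem i))
        exact ⟨c, by rw [← hc, Rat.smul_def]⟩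
      choose c hc using hc
      refine ⟨0, fun i => if i = 0 then c₀ else c i, fun _ => 0, rfl, fun i => ?_⟩
      by_cases hi : i = 0
      · subst hi; simp [h0]
      · simp [hi, hc i]
    · obtain ⟨w, hwV, hw⟩ := SetLike.not_le_iff_exists.1 hsub
      have hli : LinearIndependent ℚ ![u, w] := by
        refine LinearIndependent.pair_iff.2 fun s t hst => ?_
        rw [Rat.smul_def, Rat.smul_def] at hst
        by_cases ht : t = 0
        · rw [ht, Rat.cast_zero, zero_mul, add_zero] at hst
          have : (s : ℝ) = 0 := (mul_eq_zero.1 hst).resolve_right hu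
          exact ⟨by exact_mod_cast this, ht⟩
        · exfalso
          apply hw
          rw [Submodule.mem_span_singleton]
          refine ⟨-(s / t), ?_⟩
          rw [Rat.smul_def]
          have ht' : (t : ℝ) ≠ 0 := by exact_mod_cast ht
          push_cast
          field_simp
          linarith
      have hle : Submodule.span ℚ (Set.range ![u, w]) ≤ V := by
        refine Submodule.span_le.2 (Set.range_subset_iff.2 fun j => ?_)
        fin_cases j
        · simpa using huV
        · simpa using hwV
      have heq : Submodule.span ℚ (Set.range ![u, w]) = V := by
        refine Submodule.eq_of_le_of_finrank_le hle ?_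
        rw [finrank_span_eq_card hli]
        simpa using h
      have hc : ∀ i, ∃ c : Fin 2 → ℚ, ξ i = (c 0 : ℝ) * u + (c 1 : ℝ) * w := by
        intro i
        have hi : ξ i ∈ Submodule.span ℚ (Set.range ![u, w]) := by rw [heq]; exact hmem i
        obtain ⟨c, hc⟩ := (Submodule.mem_span_range_iff_exists_fun ℚ).1 hi
        refine ⟨c, ?_⟩
        rw [← hc, Fin.sum_univ_two, Rat.smul_def, Rat.smul_def]
        simp
      choose c hc using hc
      refine ⟨w, fun i => if i = 0 then c₀ else c i 0, fun i => if i = 0 then 0 else c i 1,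
        by simp, fun i => ?_⟩
      by_cases hi : i = 0
      · subst hi; simp [h0]
      · simp [hi, hc i]
  by_cases h0 : ξ 0 = 0
  · by_cases hall : ∀ j, ξ j = 0
    · exact ⟨1, 0, fun _ => 0, fun _ => 0, one_ne_zero, rfl, fun i => by simp [hall i]⟩
    · push Not at hall
      obtain ⟨j, hj⟩ := hall
      obtain ⟨v₂, g, f, hf, hgf⟩ := main (ξ j) 0 hj (hmem j) (by simp [h0])
      exact ⟨ξ j, v₂, g, f, hj, hf, hgf⟩
  · obtain ⟨v₂, g, f, hf, hgf⟩ := main (ξ 0) 1 h0 (hmem 0) (by simp)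
    exact ⟨ξ 0, v₂, g, f, h0, hf, hgf⟩

/-- From `|x|^{1/n} ≤ c` (`n ≥ 1`) to `|x| ≤ c^n`. [folklore] -/
private theorem abs_le_pow_of_rpow_le {x c : ℝ} {n : ℕ} (hn : n ≠ 0)
    (h : |x| ^ ((1 : ℝ) / n) ≤ c) : |x| ≤ c ^ n := by
  have h1 : (|x| ^ ((1 : ℝ) / n)) ^ n = |x| := by
    rw [one_div, Real.rpow_inv_natCast_pow (abs_nonneg x) hn]
  rw [← h1]
  exact pow_le_pow_left₀ (Real.rpow_nonneg (abs_nonneg x) _) h n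

/-- From `c ≤ y^{1/n}` (`n ≥ 1`, `y, c ≥ 0`) to `c^n ≤ y`. [folklore] -/
private theorem pow_le_of_le_rpow {y c : ℝ} {n : ℕ} (hn : n ≠ 0) (hc : 0 ≤ c) (hy : 0 ≤ y)
    (h : c ≤ y ^ ((1 : ℝ) / n)) : c ^ n ≤ y := by
  have h1 : (y ^ ((1 : ℝ) / n)) ^ n = y := by
    rw [one_div, Real.rpow_inv_natCast_pow hy hn]
  rw [← h1]
  exact pow_le_pow_left₀ hc h n

/-- **Theorem 2** of [FischlerZudilin2010], PROVED (discharge of the named fact `theorem2`), following the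
source's proof (Sect. 2.2, Proposition 1): if `dim ≤ 2`, write the forms in a basis adapted to `ξ₀`; the
`2 × 2` determinants of consecutive coordinate vectors are integers divisible by `gcd(δ_n, δ_{n+1})` and
eventually smaller than it in absolute value, hence `0`; so the coordinate vectors are eventually
proportional to a fixed integer vector, which bounds `|Σ ℓ_{i,n}ξ_i|` below — contradiction.
[cite: FischlerZudilin2010, Theorem 2 and Sect. 2.2] -/
theorem theorem2_holds : theorem2 := by
  intro r ξ ℓ α β δ hr hα0 hα1 hβ hL hℓ hδ hg
  by_contra h3
  push Not at h3
  obtain ⟨v₁, v₂, g, f, hv₁, hf0, hξ⟩ := exists_coords r ξ (by omega)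
  classical
  -- clear denominators
  set d : ℕ := ∏ i, ((g i).den * (f i).den) with hd
  have hdpos : 0 < d := Finset.prod_pos fun i _ => Nat.mul_pos (g i).den_pos (f i).den_pos
  have hdvd_g : ∀ i, (g i).den ∣ d := fun i =>
    (Dvd.intro _ rfl).trans (Finset.dvd_prod_of_mem (fun j => (g j).den * (f j).den) (Finset.mem_univ i))
  have hdvd_f : ∀ i, (f i).den ∣ d := fun i =>
    (Dvd.intro_left _ rfl).trans (Finset.dvd_prod_of_mem (fun j => (g j).den * (f j).den) (Finset.mem_univ i))
  have hint : ∀ q : ℚ, q.den ∣ d → ∃ z : ℤ, ((d : ℚ) * q) = z := by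
    intro q hq
    obtain ⟨m, hm⟩ := hq
    refine ⟨(m : ℤ) * q.num, ?_⟩
    have h1 : (q.den : ℚ) * q = q.num := Rat.den_mul_eq_num q
    rw [hm]
    push_cast
    rw [mul_comm (q.den : ℚ) (m : ℚ), mul_assoc, h1]
  choose G hG using fun i => hint (g i) (hdvd_g i)
  choose F hF using fun i => hint (f i) (hdvd_f i)
  have hF0 : F 0 = 0 := by
    have := hF 0
    rw [hf0, mul_zero] at this
    exact_mod_cast this.symm
  have hGF : ∀ i, (d : ℝ) * ξ i = G i * v₁ + F i * v₂ := by
    intro i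
    have e1 : ((d : ℝ) * (g i : ℝ)) = (G i : ℝ) := by exact_mod_cast hG i
    have e2 : ((d : ℝ) * (f i : ℝ)) = (F i : ℝ) := by exact_mod_cast hF i
    rw [hξ i, ← e1, ← e2]
    ring
  obtain ⟨g₀, hg₀, hgcd⟩ := hg
  have hαβ : 0 < α * β := mul_pos hα0 (by linarith)
  have hg₀pos : 0 < g₀ := hαβ.trans hg₀
  -- the forms are eventually non-zero and tend to zero
  set L : ℕ → ℝ := fun n => ∑ i, (ℓ n i : ℝ) * ξ i with hLdef
  have hne : ∀ᶠ n in atTop, L n ≠ 0 := by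
    have h1 : ∀ᶠ n : ℕ in atTop, α / 2 < |L n| ^ ((1 : ℝ) / n) :=
      hL.eventually (eventually_gt_nhds (by linarith))
    filter_upwards [h1, eventually_ge_atTop 1] with n hn hn1 hzero
    rw [hzero, abs_zero, Real.zero_rpow (one_div_ne_zero (by exact_mod_cast (by omega : n ≠ 0)))] at hn
    linarith
  have hupper : ∀ a' : ℝ, α < a' → ∀ᶠ n : ℕ in atTop, |L n| ≤ a' ^ n := by
    intro a' ha'
    have h1 : ∀ᶠ n : ℕ in atTop, |L n| ^ ((1 : ℝ) / n) < a' := hL.eventually (eventually_lt_nhds ha')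
    filter_upwards [h1, eventually_ge_atTop 1] with n hn hn1
    exact abs_le_pow_of_rpow_le (by omega) hn.le
  have hlim : Tendsto L atTop (𝓝 0) := by
    have ha' : α < (α + 1) / 2 := by linarith
    have h1 : Tendsto (fun n : ℕ => ((α + 1) / 2) ^ n) atTop (𝓝 0) :=
      tendsto_pow_atTop_nhds_zero_of_lt_one (by linarith) (by linarith)
    exact squeeze_zero_norm' (by simpa [Real.norm_eq_abs] using hupper _ ha') h1
  -- the quantitative smallness
  set η : ℝ := min 1 ((g₀ - α * β) / (2 * (α + β + 1))) with hη
  have hηpos : 0 < η := lt_min one_pos (div_pos (by linarith) (by linarith))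
  have hη1 : η ≤ 1 := min_le_left _ _
  have hη2 : η * (α + β + 1) ≤ (g₀ - α * β) / 2 := by
    have : η ≤ (g₀ - α * β) / (2 * (α + β + 1)) := min_le_right _ _
    rw [le_div_iff₀ (by linarith)] at this
    linarith
  set ρ : ℝ := (α + η) * (β + η) with hρ
  have hρpos : 0 < ρ := mul_pos (by linarith) (by linarith)
  have hρg : ρ < g₀ := by
    have : η * η ≤ η * 1 := mul_le_mul_of_nonneg_left hη1 hηpos.le
    nlinarith
  have hS : ∀ᶠ n : ℕ in atTop, (∑ i, |(ℓ n i : ℝ)|) ≤ (r + 1) * (β + η) ^ n := by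
    have h1 : ∀ i, ∀ᶠ n : ℕ in atTop, |(ℓ n i : ℝ)| ≤ (β + η) ^ n := by
      intro i
      filter_upwards [hℓ i (β + η) (by linarith), eventually_ge_atTop 1] with n hn hn1
      exact abs_le_pow_of_rpow_le (by omega) hn
    filter_upwards [Filter.eventually_all.2 h1] with n hn
    calc (∑ i, |(ℓ n i : ℝ)|) ≤ ∑ _i : Fin (r + 1), (β + η) ^ n := Finset.sum_le_sum fun i _ => hn i
      _ = (r + 1) * (β + η) ^ n := by simp
  have hLη : ∀ᶠ n : ℕ in atTop, |L n| ≤ (α + η) ^ n := hupper _ (by linarith)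
  have hG : ∀ᶠ n : ℕ in atTop, g₀ ^ n ≤ (Nat.gcd (δ n) (δ (n + 1)) : ℝ) := by
    filter_upwards [hgcd, eventually_ge_atTop 1] with n hn hn1
    exact pow_le_of_le_rpow (by omega) hg₀pos.le (by positivity) hn
  refine core r ξ ℓ δ v₁ v₂ hv₁ G F hF0 d hdpos hGF
    (eventually_atTop.2 ⟨1, fun n hn => hδ n hn⟩) hne hlim fun C => ?_
  -- `C · (S_n |L_{n+1}| + S_{n+1} |L_n|) ≤ |C| (r+1) (α+β+2η) ρ^n < g₀^n ≤ gcd`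
  set K : ℝ := |C| * ((r + 1) * (α + β + 2 * η)) with hK
  have hK0 : 0 ≤ K := by positivity
  have hsmallK : ∀ᶠ n : ℕ in atTop, K * (ρ / g₀) ^ n < 1 := by
    have h1 : Tendsto (fun n : ℕ => K * (ρ / g₀) ^ n) atTop (𝓝 (K * 0)) :=
      (tendsto_pow_atTop_nhds_zero_of_lt_one (by positivity) ((div_lt_one hg₀pos).2 hρg)).const_mul K
    rw [mul_zero] at h1
    exact h1.eventually (eventually_lt_nhds one_pos)
  filter_upwards [hS, (tendsto_add_atTop_nat 1).eventually hS, hLη,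
    (tendsto_add_atTop_nat 1).eventually hLη, hG, hsmallK] with n hS0 hS1 hL0 hL1 hGn hKn
  have hb : 0 ≤ β + η := by linarith
  have ha : 0 ≤ α + η := by linarith
  have hsum0 : 0 ≤ (∑ i, |(ℓ n i : ℝ)|) := Finset.sum_nonneg fun i _ => abs_nonneg _
  have hsum1 : 0 ≤ (∑ i, |(ℓ (n + 1) i : ℝ)|) := Finset.sum_nonneg fun i _ => abs_nonneg _
  have step1 : C * ((∑ i, |(ℓ n i : ℝ)|) * |L (n + 1)| + (∑ i, |(ℓ (n + 1) i : ℝ)|) * |L n|) ≤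
      |C| * (((r + 1) * (β + η) ^ n) * (α + η) ^ (n + 1) +
             ((r + 1) * (β + η) ^ (n + 1)) * (α + η) ^ n) := by
    refine (le_abs_self _).trans ?_
    rw [abs_mul]
    refine mul_le_mul_of_nonneg_left ?_ (abs_nonneg C)
    rw [abs_of_nonneg (by positivity)]
    gcongr
  have step2 : |C| * (((r + 1) * (β + η) ^ n) * (α + η) ^ (n + 1) +
      ((r + 1) * (β + η) ^ (n + 1)) * (α + η) ^ n) = K * ρ ^ n := by
    rw [hK, hρ, mul_pow]
    ring
  have step3 : K * ρ ^ n < g₀ ^ n := by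
    have hg0n : 0 < g₀ ^ n := pow_pos hg₀pos n
    have hne' : g₀ ^ n ≠ 0 := hg0n.ne'
    have : K * ρ ^ n = K * (ρ / g₀) ^ n * g₀ ^ n := by
      rw [div_pow]
      field_simp
    rw [this]
    calc K * (ρ / g₀) ^ n * g₀ ^ n < 1 * g₀ ^ n := by gcongr
      _ = g₀ ^ n := one_mul _
  calc C * ((∑ i, |(ℓ n i : ℝ)|) * |L (n + 1)| + (∑ i, |(ℓ (n + 1) i : ℝ)|) * |L n|)
      ≤ K * ρ ^ n := step1.trans_eq step2
    _ < g₀ ^ n := step3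
    _ ≤ _ := hGn

end Literature.NumberTheory.Irrationality.FischlerZudilin2010
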